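import Literature.Barriers.FinalStateConjecture.NonSmoothNullInfinity
import Mathlib.Analysis.Calculus.IteratedDeriv.Defs
import HarnessLib

/-!
# Barrier catalogue `FinalStateConjecture`: the linear scattering problem on Schwarzschild behind
# `KehrbergerLogarithmicAsymptoticsCorrected` — named ingredients and the reduction
(`Literature/Barriers/FinalStateConjecture/`, D-0021, D-0014; family `gr`; namespace
`Literature.Barriers.FinalStateConjecture`)

`NonSmoothNullInfinity.lean` vendors Kehrberger's Thm. 6.2 (arXiv:2105.08079v3 sign) as the named fact
`KehrbergerLogarithmicAsymptoticsCorrected`: for compactly supported scattering data `G` on `𝓘⁻` whose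
first non-vanishing moment is `I⁽ⁿ⁾[G]`, THE scattering solution `ψ = rφ` of the spherically symmetric
linear wave equation `∂ᵤ∂ᵥ(rφ) = −2M(1 − 2M/r) rφ/r³` (§6.2, eq. (6.14)) exists, vanishes for `v ≤ v₁`,
attains `G` on `𝓘⁻`, and obeys the two printed estimates (6.17) (the `|u|`-decay) and (6.18) (the
expansion of `∂ᵥ(rφ)` towards `𝓘⁺` with its logarithmic term). Discharging it is a theory-sized task
(triage XL: existence and smoothness of the semi-infinite characteristic problem with data at `𝓘⁻`,
uniform decay, and a two-parameter induction for the asymptotic expansion — none of it in Mathlib).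
Following D-0014 and the precedent of `ExtremalHorizonInstabilityProofs.lean`, this file

* fixes the uniqueness class in which "the scattering solution" is meant here
  (`IsScatteringSolution`: a smooth radiation field vanishing for `v ≤ v₁`, attaining `G` on `𝓘⁻`,
  and locally bounded towards the past — the class in which existence AND uniqueness are proved in
  the sequel files; Kehrberger quotes uniqueness "in the class of finite-energy solutions" from
  Dafermos–Rodnianski–Shlapentokh-Rothman, which is not the class formalised here);
* vendors the printed ingredients of the proof of Thm. 6.2 as **named facts** (each to be discharged
  bottom-up in sibling `…Proofs` files):
  `SchwarzschildLinearScattering_exists` / `SchwarzschildLinearScattering_unique` (existence and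
  uniqueness of the scattering solution, Thm. 6.2, first paragraph, with Thm. 6.1),
  `SchwarzschildLinearScattering_timeIntegral` (the time-integral identity `rφ = T(rφ^T)`,
  `T = ∂ᵤ + ∂ᵥ`, of the proof of Thm. 6.2, eqs. (6.22)–(6.23)),
  `SchwarzschildLinearScattering_futureLimit` (`rφ(u, ∞) = lim_{v → ∞} rφ(u, v)` exists and is smooth
  in `u`; used in the proof of Thm. 6.2 through `rφ^T(u,v) = rφ^T(u,∞) − ∫_v^∞ ∂ᵥ(rφ^T)` and in
  Thm. 4.3/6.1 through `F(u) = ∫_{−∞}^u lim_{v→∞}(2mν rφ)`),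
  `SchwarzschildLinearScattering_uDecay` (estimate (6.17) for every `n`), and
  `SchwarzschildLinearScattering_logExpansion` (estimate (6.18) in the `∂ᵥ^m`-commuted form used as
  induction hypothesis in the proof of Thm. 6.2 — "we assume that (6.18) holds for some `n` and
  moreover commutes with `∂ᵥ^m` for all `m`" — rendered as: the remainder of (6.18) is a symbol of
  order `−4 − n` in `r` along each outgoing cone, i.e. its `m`-th `v`-derivative is `O(r^{−4−n−m})`);
* **proves** the reduction
  `KehrbergerLogarithmicAsymptoticsCorrected.of_facts : …_exists → …_uDecay → …_logExpansion →
  KehrbergerLogarithmicAsymptoticsCorrected` (take the scattering solution, restrict to the smaller of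
  the two `U₀`, specialise the expansion to `m = 0`).

The dependency graph of the intended discharge (recorded here so that the sequel files can be read
against it): existence/uniqueness/regularity of the scattering solution (a fixed point of
`ψ = G − ∫_{−∞}^u ∫_{v₁}^v V ψ`, `V = 2M(1−2M/r)/r³`, in weighted sup norms; smoothness by
differentiating under the integral) ⟹ `_exists`, `_unique`, `_futureLimit`, `_timeIntegral`;
uniform decay on `{u ≤ U₀, v ≥ v₂}` and the `n`-fold time integral `rφ = Tⁿ(rφ^{[n]})` with
`I₀[G^{[n]}] = I⁽ⁿ⁾[G]` (`kehrbergerMoment_scatteringTimeIntegral`) ⟹ `_uDecay`; the case `n = 0` of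
`_logExpansion` (Thm. 6.1, eq. (6.5) of v3, by commuting the wave equation with `r³` and integrating
from `𝓘⁻`, proof of Thm. 4.3, with remainders uniform in `u`) and the time-integral step
`∂ᵥ(rφ) = ∂ᵥ²(rφ^T) − V rφ^T` (proof of Thm. 6.2) ⟹ `_logExpansion` for all `n` by induction.
When the three facts used by `of_facts` are discharged,
`theorem KehrbergerLogarithmicAsymptoticsCorrected_holds := .of_facts ‹_› ‹_› ‹_›` lands here
(append protocol).

## References

* L. M. A. Kehrberger, *The case against smooth null infinity I: heuristics and counter-examples*,
  Ann. Henri Poincaré 23 (2022) 829–921 = arXiv:2105.08079 (v3, 2023, for the sign in (6.18)):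
  §6.1 Thm. 6.1, §6.2 eq. (6.14) and Thm. 6.2 with its proof (time integrals, eqs. (6.22)–(6.25)),
  §4.4 Thms. 4.2–4.3 and Remark 4.5 (higher `∂ᵥ`-derivatives), App. B Thm. B.1. Key
  `Kehrberger2022AHP`.
* M. Dafermos, I. Rodnianski, Y. Shlapentokh-Rothman, *A scattering theory for the wave equation on
  Kerr black hole exteriors*, Ann. Sci. ÉNS 51 (2018) 371–486. Key
  `DafermosRodnianskiShlapentokhrothman2018` (existence and uniqueness of scattering solutions in the
  finite-energy class, quoted by Kehrberger, Thm. 6.2).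
-/

noncomputable section

open MeasureTheory Set Filter Topology Asymptotics Finset

namespace Literature.Barriers.FinalStateConjecture

/-! ### The scattering solution: the uniqueness class -/

/-- `ψ = rφ` is **a scattering solution of the spherically symmetric linear wave equation on the
Schwarzschild exterior of mass `M` (EF area radius `r`) with data `G` on `𝓘⁻`, no data before the
advanced time `v₁`, and vanishing data on `𝓗⁻`**: `ψ` is a smooth radiation field
(`IsRadiationFieldOnSchwarzschild`, eq. (6.14)), "`φ(u,v) = 0` for all `v ≤ v₁`", "`rφ|_{𝓘⁻}(v) = G(v)`
for all `v ∈ ℝ`" (Kehrberger, Thm. 6.1, which "also applies in the case of the linear wave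
equation", §6.2), i.e. `ψ(u, v) → G(v)` as `u → −∞` for every `v`, and — the uniqueness class used in
this library — `ψ` is bounded on every quadrant `{u ≤ U, v ≤ V}` (local boundedness towards the past;
it holds for the solution constructed in the sequel and makes it unique, whereas Kehrberger quotes
uniqueness "in the class of finite-energy solutions" from Dafermos–Rodnianski–Shlapentokh-Rothman,
Thm. 6.2). Vanishing data on `𝓗⁻` are implied by `ψ = 0` for `v ≤ v₁` ("since we always restrict to
a region sufficiently close to `𝓘⁻` [...] we may without loss of generality assume vanishing data on
`𝓗⁻`", §6, footnote).
[cite: Kehrberger2022AHP, Thm. 6.1 and §6.2 (eq. (6.14), Thm. 6.2)] -/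
def IsScatteringSolution (M : ℝ) (r : ℝ → ℝ → ℝ) (v₁ : ℝ) (G : ℝ → ℝ) (ψ : ℝ → ℝ → ℝ) : Prop :=
  IsRadiationFieldOnSchwarzschild M r ψ ∧
    (∀ u v, v ≤ v₁ → ψ u v = 0) ∧
    (∀ v, Tendsto (fun u ↦ ψ u v) atBot (𝓝 (G v))) ∧
    ∀ U V : ℝ, ∃ B : ℝ, ∀ u, u ≤ U → ∀ v, v ≤ V → |ψ u v| ≤ B

namespace IsScatteringSolution

variable {M : ℝ} {r : ℝ → ℝ → ℝ} {v₁ : ℝ} {G : ℝ → ℝ} {ψ : ℝ → ℝ → ℝ}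

/-- A scattering solution is a smooth radiation field. [folklore] -/
lemma isRadiationField (h : IsScatteringSolution M r v₁ G ψ) :
    IsRadiationFieldOnSchwarzschild M r ψ := h.1

/-- A scattering solution vanishes for `v ≤ v₁`. [folklore] -/
lemma eq_zero (h : IsScatteringSolution M r v₁ G ψ) {u v : ℝ} (hv : v ≤ v₁) : ψ u v = 0 :=
  h.2.1 u v hv

/-- A scattering solution attains its data on `𝓘⁻`: `ψ(u,v) → G(v)` as `u → −∞`. [folklore] -/
lemma tendsto_atBot (h : IsScatteringSolution M r v₁ G ψ) (v : ℝ) :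
    Tendsto (fun u ↦ ψ u v) atBot (𝓝 (G v)) := h.2.2.1 v

/-- A scattering solution is bounded on every past quadrant `{u ≤ U, v ≤ V}`. [folklore] -/
lemma exists_bound (h : IsScatteringSolution M r v₁ G ψ) (U V : ℝ) :
    ∃ B : ℝ, ∀ u, u ≤ U → ∀ v, v ≤ V → |ψ u v| ≤ B := h.2.2.2 U V

end IsScatteringSolution

/-! ### The named ingredients of the proof of Thm. 6.2 -/

/-- **Existence of the scattering solution** (named fact, D-0014). "Prescribe compactly supported
scattering data `G(v)` on `𝓘⁻` [...] Then [...] there exists a unique smooth scattering solution `φ`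
attaining these data" (Kehrberger, Thm. 6.2, quoting Dafermos–Rodnianski–Shlapentokh-Rothman; also
"The existence of the scattering solution `φ` follows by our previous methods", proof of Thm. 6.2, and
Thm. 6.1: "there exists a solution [...] which satisfies `φ(u,v) = 0` for all `v ≤ v₁` [...] and
`rφ|_{𝓘⁻}(v) = G(v)`"). Formal content: for `M > 0`, an EF area radius `r`, and smooth `G` supported in
`(v₁, v₂)`, some `ψ` satisfies `IsScatteringSolution M r v₁ G ψ`. (Intended discharge: the fixed point of
`ψ = G − ∫_{−∞}^u ∫_{v₁}^v 2M(1 − 2M/r) ψ/r³ dv' du'` in a weighted sup norm.)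
[cite: Kehrberger2022AHP, Thm. 6.2 (first paragraph) and Thm. 6.1] -/
def SchwarzschildLinearScattering_exists : Prop :=
  ∀ (M : ℝ), 0 < M → ∀ (r : ℝ → ℝ → ℝ), IsEFAreaRadius M r →
  ∀ (G : ℝ → ℝ) (v₁ v₂ : ℝ), v₁ < v₂ → ContDiff ℝ ((⊤ : ℕ∞) : WithTop ℕ∞) G →
    tsupport G ⊆ Ioo v₁ v₂ →
  ∃ ψ : ℝ → ℝ → ℝ, IsScatteringSolution M r v₁ G ψ

/-- **Uniqueness of the scattering solution** in the class `IsScatteringSolution` (named fact,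
D-0014): two scattering solutions with the same mass, area radius, initial advanced time and data
coincide ("there exists a unique smooth scattering solution", Kehrberger, Thm. 6.2; there "the
uniqueness being understood in the class of finite-energy solutions" after
Dafermos–Rodnianski–Shlapentokh-Rothman — here in the class of solutions locally bounded towards the
past, in which it is an elementary Grönwall/contraction argument for the integrated equation
`ψ = G − ∫_{−∞}^u ∫_{v₁}^v Vψ`). No support hypothesis on `G` is needed.
[cite: Kehrberger2022AHP, Thm. 6.2 (first paragraph)] -/
def SchwarzschildLinearScattering_unique : Prop :=
  ∀ (M : ℝ), 0 < M → ∀ (r : ℝ → ℝ → ℝ), IsEFAreaRadius M r →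
  ∀ (G : ℝ → ℝ) (v₁ : ℝ) (ψ₁ ψ₂ : ℝ → ℝ → ℝ),
    IsScatteringSolution M r v₁ G ψ₁ → IsScatteringSolution M r v₁ G ψ₂ → ψ₁ = ψ₂

/-- **The time-integral identity `rφ = T(rφ^T)`, `T = ∂ᵤ + ∂ᵥ`** (named fact, D-0014; proof of
Thm. 6.2): "The goal is to show that `rφ` can be written as `T(rφ^T)`, where `T = ∂ᵤ + ∂ᵥ`, and where
`rφ^T`, the time integral of `rφ`, is another solution coming from compactly supported data `G^T`
[...] we take the obvious candidate for `G^T`: `G^T(v) = ∫_{v₁}^v G(v') dv'` [...] the solution `rφ^T`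
arising from this satisfies `T(rφ^T)(−∞, v) = ∂ᵥ(rφ^T)(−∞, v) = (G^T)'(v) = G(v)`. Therefore, since
`T` also commutes with the wave equation, we indeed have `T(rφ^T) = rφ` by uniqueness." Formal
content: if `∫ G = 0` (so that `G^T = scatteringTimeIntegral v₁ G` is again supported in `(v₁, v₂)`,
`tsupport_scatteringTimeIntegral_subset`), `ψ` is a scattering solution with data `G` and `ψT` one with
data `G^T`, then `ψ(u,v) = ∂ᵤψT(u,v) + ∂ᵥψT(u,v)` everywhere.
[cite: Kehrberger2022AHP, proof of Thm. 6.2, eqs. (6.22)–(6.23)] -/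
def SchwarzschildLinearScattering_timeIntegral : Prop :=
  ∀ (M : ℝ), 0 < M → ∀ (r : ℝ → ℝ → ℝ), IsEFAreaRadius M r →
  ∀ (G : ℝ → ℝ) (v₁ v₂ : ℝ), v₁ < v₂ → ContDiff ℝ ((⊤ : ℕ∞) : WithTop ℕ∞) G →
    tsupport G ⊆ Ioo v₁ v₂ → ∫ v, G v = 0 →
  ∀ (ψ ψT : ℝ → ℝ → ℝ), IsScatteringSolution M r v₁ G ψ →
    IsScatteringSolution M r v₁ (scatteringTimeIntegral v₁ G) ψT →
  ∀ u v, ψ u v = deriv (fun u' ↦ ψT u' v) u + deriv (fun v' ↦ ψT u v') v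

/-- **The radiation field attains a limit on `𝓘⁺`, smoothly in `u`** (named fact, D-0014). In the
proofs of Thms. 4.3 and 6.1–6.2 Kehrberger uses that "`rφ` attain[s] a limit on `𝓘⁺`", written
`rφ(u, ∞)`, that `F(u) = ∫_{−∞}^u lim_{v→∞}(2mν rφ)(u', v) du'` is one of the "smooth functions
`f_i`" of the expansion, and (proof of Thm. 6.2) "`rφ^T(u,v) = rφ^T(u,∞) − ∫_v^∞ ∂ᵥ(rφ^T)(u,v') dv'`".
Formal content: for a scattering solution `ψ` (data smooth and supported in `(v₁, v₂)`), there are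
`U₀ < −1` and a function `ψinf`, smooth on `(−∞, U₀)`, with `ψ(u, v) → ψinf(u)` as `v → ∞` for every
`u < U₀` (only the neighbourhood `u < U₀` of `i⁰`/`𝓘⁻` where all the estimates live is asserted).
[cite: Kehrberger2022AHP, proof of Thm. 4.3 and proof of Thm. 6.2] -/
def SchwarzschildLinearScattering_futureLimit : Prop :=
  ∀ (M : ℝ), 0 < M → ∀ (r : ℝ → ℝ → ℝ), IsEFAreaRadius M r →
  ∀ (G : ℝ → ℝ) (v₁ v₂ : ℝ), v₁ < v₂ → ContDiff ℝ ((⊤ : ℕ∞) : WithTop ℕ∞) G →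
    tsupport G ⊆ Ioo v₁ v₂ →
  ∀ (ψ : ℝ → ℝ → ℝ), IsScatteringSolution M r v₁ G ψ →
  ∃ U₀ : ℝ, U₀ < -1 ∧ ∃ ψinf : ℝ → ℝ, ContDiffOn ℝ ((⊤ : ℕ∞) : WithTop ℕ∞) ψinf (Iio U₀) ∧
    ∀ u, u < U₀ → Tendsto (fun v ↦ ψ u v) atTop (𝓝 (ψinf u))

/-- **The `|u|`-decay of the scattering solution, eq. (6.17)** (named fact, D-0014): "Let `n` denote
the smallest natural number such that `I⁽ⁿ⁾[G] ≠ 0`. Then the solution `φ` satisfies, for all `v ≥ v₂`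
and for all `u < U₀`, and for sufficiently large negative values of `U₀`:
`|rφ(u,v) + I⁽ⁿ⁾[G] (n+1)!/|u|^{2+n}| = O(|u|^{−3−n} log|u|)`" (Kehrberger, Thm. 6.2, eq. (6.17); the
case `n = 0` is Thm. 6.1, eq. (6.3), with the `log|u|` of the EF gauge, §6.2 footnote 55). Formal
content, in the shape of clause (1) of `KehrbergerLogarithmicAsymptoticsCorrected`: for every
scattering solution `ψ` with data `G` (smooth, supported in `(v₁, v₂)`) whose moments `I⁽ᵏ⁾[G]`,
`k < n`, vanish, there are `U₀ < −1` and `C` with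
`|ψ(u,v) + I⁽ⁿ⁾[G](n+1)!/|u|^{2+n}| ≤ C log|u|/|u|^{3+n}` for `u < U₀`, `v ≥ v₂`. The hypothesis
`I⁽ⁿ⁾[G] ≠ 0` of the source is not needed for this estimate and is omitted (for `I⁽ⁿ⁾[G] = 0` the
statement is the weaker half of the case `n + 1`). (Intended discharge: `rφ = Tⁿ(rφ^{[n]})` for the
`n`-fold time integral `G^{[n]}`, `I₀[G^{[n]}] = I⁽ⁿ⁾[G]`, and the `∂ᵤ`-derivatives of the case `n = 0`
along `v = v₂`, cf. "we moreover assume that it commutes with `∂ᵤ`", proof of Thm. 6.2.)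
[cite: Kehrberger2022AHP, Thm. 6.2 eq. (6.17), Thm. 6.1 eq. (6.3) and §6.2 footnote 55] -/
def SchwarzschildLinearScattering_uDecay : Prop :=
  ∀ (M : ℝ), 0 < M → ∀ (r : ℝ → ℝ → ℝ), IsEFAreaRadius M r →
  ∀ (G : ℝ → ℝ) (v₁ v₂ : ℝ), v₁ < v₂ → ContDiff ℝ ((⊤ : ℕ∞) : WithTop ℕ∞) G →
    tsupport G ⊆ Ioo v₁ v₂ →
  ∀ n : ℕ, (∀ k < n, kehrbergerMoment M G k = 0) →
  ∀ (ψ : ℝ → ℝ → ℝ), IsScatteringSolution M r v₁ G ψ →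
  ∃ U₀ : ℝ, U₀ < -1 ∧ ∃ C : ℝ, ∀ u, u < U₀ → ∀ v, v₂ ≤ v →
    |ψ u v + kehrbergerMoment M G n * ((n + 1).factorial : ℝ) / |u| ^ (2 + n)| ≤
      C * Real.log |u| / |u| ^ (3 + n)

/-- **The expansion of `∂ᵥ(rφ)` towards `𝓘⁺` with its logarithmic term, eq. (6.18) of arXiv v3, in
the `∂ᵥ^m`-commuted form of the proof of Thm. 6.2** (named fact, D-0014): "for fixed values of `u`,
we have the following asymptotic expansion as `𝓘⁺` is approached:
`∂ᵥ(rφ) = Σ_{i=0}^{n} f_i⁽ⁿ⁾(u)/r^{3+i} − (−1)ⁿ (3+n)! I⁽ⁿ⁾[G] M (log r − log|u|)/r^{4+n} + O(r^{−4−n})`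
for some smooth functions `f_i⁽ⁿ⁾`" (Thm. 6.2, eq. (6.18), sign of arXiv:2105.08079v3 — see the
§Erratum of `NonSmoothNullInfinity.lean`), together with the induction hypothesis of its proof: "We
again make the inductive assumption that (6.18) holds for some `n` and moreover commutes with `∂ᵥ^m`
for all `m` [...] `∂ᵥ^m(∂ᵥ(rφ)) = Σ_{i=0}^{n} f_i^{(n,m)}(u)/r^{3+i+m} + [log term] ∂ᵥ^m(log r/r^{4+n})
+ O(r^{−4−n−m})`" (proof of Thm. 6.2; for `n = 0` this is Thm. 6.1, eq. (6.5), with Remark 4.5,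
"one can commute the two wave equations for `r` and `rφ` with `∂ᵥ` to obtain similar results for
higher derivatives"). Formal content, in the shape of clause (2) of
`KehrbergerLogarithmicAsymptoticsCorrected` at `m = 0`: for every scattering solution `ψ` with data `G`
(smooth, supported in `(v₁, v₂)`) whose moments `I⁽ᵏ⁾[G]`, `k < n`, vanish, there are `U₀ < −1` and
functions `f_i`, smooth on `(−∞, U₀)`, such that for every `u < U₀` the remainder
`R_u(v) := ∂ᵥψ(u,v) − Σ_{i≤n} f_i(u)/r^{3+i} + (−1)ⁿ(n+3)! I⁽ⁿ⁾[G] M (log r − log|u|)/r^{4+n}`,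
`r = r(u,v)`, is a symbol of order `−4 − n` along the outgoing cone: `R_u^{(m)}(v) = O(r^{−4−n−m})`
as `v → ∞`, for every `m` (since `∂ᵥ r = 1 − 2M/r`, `v`-derivatives of the printed terms are again
finite sums of the printed shape one order down, so this is the quoted `∂ᵥ^m`-commuted statement with
the bookkeeping of the explicit terms left implicit). As for `_uDecay`, `I⁽ⁿ⁾[G] ≠ 0` is not needed
and is omitted. (Intended discharge: `n = 0` by commuting the wave equation with `r³` and integrating
from `𝓘⁻` with `u`-uniform remainders, proof of Thm. 4.3; the step `n − 1 ↦ n` by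
`∂ᵥ(rφ) = ∂ᵥ²(rφ^T) − 2M(1 − 2M/r) rφ^T/r³`, proof of Thm. 6.2, using `_timeIntegral` and
`_futureLimit`.)
[cite: Kehrberger2022AHP, Thm. 6.2 eq. (6.18) and its proof (arXiv v3), Thm. 6.1 eq. (6.5), Remark 4.5] -/
def SchwarzschildLinearScattering_logExpansion : Prop :=
  ∀ (M : ℝ), 0 < M → ∀ (r : ℝ → ℝ → ℝ), IsEFAreaRadius M r →
  ∀ (G : ℝ → ℝ) (v₁ v₂ : ℝ), v₁ < v₂ → ContDiff ℝ ((⊤ : ℕ∞) : WithTop ℕ∞) G →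
    tsupport G ⊆ Ioo v₁ v₂ →
  ∀ n : ℕ, (∀ k < n, kehrbergerMoment M G k = 0) →
  ∀ (ψ : ℝ → ℝ → ℝ), IsScatteringSolution M r v₁ G ψ →
  ∃ U₀ : ℝ, U₀ < -1 ∧
    ∃ f : ℕ → ℝ → ℝ, (∀ i, ContDiffOn ℝ ((⊤ : ℕ∞) : WithTop ℕ∞) (f i) (Iio U₀)) ∧
      ∀ u, u < U₀ → ∀ m : ℕ,
        (iteratedDeriv m (fun v ↦ deriv (fun v' ↦ ψ u v') v -
            (∑ i ∈ Finset.range (n + 1), f i u / r u v ^ (3 + i)) +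
            (-1) ^ n * ((n + 3).factorial : ℝ) * kehrbergerMoment M G n * M *
              (Real.log (r u v) - Real.log |u|) / r u v ^ (4 + n)))
          =O[atTop] (fun v ↦ 1 / r u v ^ (4 + n + m))

/-! ### The reduction -/

/-- **Reduction of `KehrbergerLogarithmicAsymptoticsCorrected` to the named ingredients** (proved):
existence of the scattering solution, the `|u|`-decay (6.17) and the (`∂ᵥ^m`-commuted) expansion
(6.18) imply the barrier fact — take the scattering solution `ψ` given by `_exists`, the smaller of the
two thresholds `U₀`, and the case `m = 0` of the expansion (`iteratedDeriv 0 R = R`). When the three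
facts are discharged, `KehrbergerLogarithmicAsymptoticsCorrected_holds := .of_facts ‹_› ‹_› ‹_›`.
[cite: Kehrberger2022AHP, Thm. 6.2] -/
theorem KehrbergerLogarithmicAsymptoticsCorrected.of_facts
    (hex : SchwarzschildLinearScattering_exists)
    (hdec : SchwarzschildLinearScattering_uDecay)
    (hexp : SchwarzschildLinearScattering_logExpansion) :
    KehrbergerLogarithmicAsymptoticsCorrected := by
  intro M hM r hr G v₁ v₂ hv hG hsupp n hlt _hn
  obtain ⟨ψ, hψ⟩ := hex M hM r hr G v₁ v₂ hv hG hsupp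
  obtain ⟨U₁, hU₁, C, hC⟩ := hdec M hM r hr G v₁ v₂ hv hG hsupp n hlt ψ hψ
  obtain ⟨U₂, -, f, hf, hE⟩ := hexp M hM r hr G v₁ v₂ hv hG hsupp n hlt ψ hψ
  refine ⟨ψ, hψ.isRadiationField, fun u v huv ↦ hψ.eq_zero huv, hψ.tendsto_atBot, min U₁ U₂,
    lt_of_le_of_lt (min_le_left _ _) hU₁, ?_, ?_⟩
  · exact ⟨C, fun u hu v hv' ↦ hC u (lt_of_lt_of_le hu (min_le_left _ _)) v hv'⟩
  · refine ⟨f, fun i ↦ (hf i).mono (Iio_subset_Iio (min_le_right _ _)), fun u hu ↦ ?_⟩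
    have h0 := hE u (lt_of_lt_of_le hu (min_le_right _ _)) 0
    simpa only [iteratedDeriv_zero, add_zero] using h0

end Literature.Barriers.FinalStateConjecture

end
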